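import Mathlib

/-!
# Crux `ExactCertificate` (stmt-AtomisticToContinuum-11959), line `closure-makes-nogap-exact`,
# skeleton VIII (`InvisibilityDichotomy`): stub `stub_coincidenceFinite`

Support file for the crux `ThreeConeCertificate.ExactCertificate`, skeleton VIII
(`Cruxes.ExactCertificate.Invisibility.InvisibilityDichotomy`: no nonzero finite-range continuous
radial kernel on `ℝ³` has Fourier transform vanishing on a lattice minus the origin).  The counting
engine of that skeleton needs the distinct norms `‖n k₁ + j k₂‖` of a rank-2 lattice to be
superlinear in the radius; the present stub is the arithmetic input: two DISTINCT lattice lines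
`j < j'` share only finitely many squared norms.  With Gram data `A = ‖k₁‖²`, `B = ⟪k₁, k₂⟫`,
`C = ‖k₂‖²` (`0 < A`, `B² < A C`) and `Q(n, j) := A n² + 2 B j n + C j²`, the set
`S := {(n, n') ∈ ℤ² | Q(n, j) = Q(n', j')}` is finite.

Proof.  For `(n, n') ∈ S` the integer vector `v(n, n') := (n² − n'², j n − j' n')` satisfies the
real relation `A v₁ + 2 B v₂ + C (j² − j'²) = 0`, with `j² − j'² ≠ 0`.
* If two elements of `S` have different `v`, the two relations force `(A, B, C)` to be a real
  multiple of an INTEGER vector `(a, b, c)` (a cross product), with `a ≠ 0`, `b² < a c`; every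
  element of `S` then satisfies the integer identity `a n² + 2 b j n + c j² = a n'² + …`, i.e.
  `(a n + b j)² − (a n' + b j')² = (a c − b²)(j'² − j²) =: K ≥ 1`, a factorisation of the fixed
  nonzero integer `K`, whence `|n|, |n'| ≤ K + |b| j'`.
* Otherwise all elements share one `v = (P₁, P₂)`: `(n − n')(n + n') = P₁` and
  `j n − j' n' = P₂` give `|n|, |n'| ≤ |P₁| + |P₂|` (factorise if `P₁ ≠ 0`; if `P₁ = 0` then
  `n' = ± n` and `(j ∓ j') n = P₂` with `j ∓ j' ≠ 0`).
In both cases `S` lies in a finite box.  Pure Mathlib, private helpers only.  All `[folklore]`.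
-/

noncomputable section

namespace Summit.AtomisticToContinuum.Crystallization.Theorems.ThreeConeCertificateExactCertificate.Invisibility

/-- If `u * w = K` with `u ≠ 0` (integers) then `|w| ≤ |K|`. [folklore] -/
private theorem abs_le_of_ne_zero_mul (u w K : ℤ) (h : u * w = K) (hu : u ≠ 0) : |w| ≤ |K| :=
  calc |w| = 1 * |w| := (one_mul _).symm
    _ ≤ |u| * |w| := mul_le_mul_of_nonneg_right (Int.one_le_abs hu) (abs_nonneg _)
    _ = |K| := by rw [← abs_mul, h]

/-- If `u * w = K ≠ 0` (integers) then `|u| ≤ |K|` and `|w| ≤ |K|`. [folklore] -/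
private theorem abs_le_of_mul_eq_ne_zero (u w K : ℤ) (h : u * w = K) (hK : K ≠ 0) :
    |u| ≤ |K| ∧ |w| ≤ |K| := by
  have hu : u ≠ 0 := by
    rintro rfl
    exact hK (by rw [← h, zero_mul])
  have hw : w ≠ 0 := by
    rintro rfl
    exact hK (by rw [← h, mul_zero])
  exact ⟨abs_le_of_ne_zero_mul w u K ((mul_comm _ _).trans h) hw,
    abs_le_of_ne_zero_mul u w K h hu⟩

/-- `0 ≤ j < j'` gives `0 < j'² − j²`. [folklore] -/
private theorem sq_sub_sq_pos {j j' : ℤ} (hj : 0 ≤ j) (hjj' : j < j') : 0 < j' ^ 2 - j ^ 2 := by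
  nlinarith [mul_pos (sub_pos.2 hjj') (sub_pos.2 hjj'), mul_nonneg hj (sub_pos.2 hjj').le]

/-- Commensurable case: for an INTEGER positive-definite form (`a ≠ 0`, `b² < a c`) the solutions
of `a n² + 2 b j n + c j² = a n'² + 2 b j' n' + c j'²` (`0 ≤ j < j'`) lie in an explicit box,
because `(a n + b j)² − (a n' + b j')²` is the fixed positive integer `(a c − b²)(j'² − j²)`.
[folklore] -/
private theorem intForm_bound (a b c j j' n n' : ℤ) (ha : a ≠ 0) (hbac : b ^ 2 < a * c)
    (hj : 0 ≤ j) (hjj' : j < j')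
    (h : a * n ^ 2 + 2 * b * j * n + c * j ^ 2 = a * n' ^ 2 + 2 * b * j' * n' + c * j' ^ 2) :
    |n| ≤ (a * c - b ^ 2) * (j' ^ 2 - j ^ 2) + |b| * j' ∧
      |n'| ≤ (a * c - b ^ 2) * (j' ^ 2 - j ^ 2) + |b| * j' := by
  have hKpos : 0 < (a * c - b ^ 2) * (j' ^ 2 - j ^ 2) :=
    mul_pos (by linarith) (sq_sub_sq_pos hj hjj')
  have hprod : (a * n + b * j - (a * n' + b * j')) * (a * n + b * j + (a * n' + b * j')) =
      (a * c - b ^ 2) * (j' ^ 2 - j ^ 2) := by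
    linear_combination a * h
  obtain ⟨hu, hw⟩ := abs_le_of_mul_eq_ne_zero _ _ _ hprod hKpos.ne'
  rw [abs_of_pos hKpos, abs_le] at hu hw
  obtain ⟨hu1, hu2⟩ := hu
  obtain ⟨hw1, hw2⟩ := hw
  have hb1 : -(|b| * j') ≤ b * j ∧ b * j ≤ |b| * j' := by
    have : |b * j| ≤ |b| * j' := by
      rw [abs_mul, abs_of_nonneg hj]
      exact mul_le_mul_of_nonneg_left hjj'.le (abs_nonneg _)
    exact abs_le.1 this
  have hb2 : -(|b| * j') ≤ b * j' ∧ b * j' ≤ |b| * j' := by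
    have : |b * j'| ≤ |b| * j' := by
      rw [abs_mul, abs_of_nonneg (hj.trans hjj'.le)]
    exact abs_le.1 this
  have ha1 : 1 ≤ |a| := Int.one_le_abs ha
  have hn : |n| ≤ |a * n| := by
    rw [abs_mul]
    exact le_mul_of_one_le_left (abs_nonneg _) ha1
  have hn' : |n'| ≤ |a * n'| := by
    rw [abs_mul]
    exact le_mul_of_one_le_left (abs_nonneg _) ha1
  have han : |a * n| ≤ (a * c - b ^ 2) * (j' ^ 2 - j ^ 2) + |b| * j' := by
    rw [abs_le]
    constructor <;> linarith
  have han' : |a * n'| ≤ (a * c - b ^ 2) * (j' ^ 2 - j ^ 2) + |b| * j' := by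
    rw [abs_le]
    constructor <;> linarith
  exact ⟨hn.trans han, hn'.trans han'⟩

/-- Incommensurable case: if `n² − n'² = P₁` and `j n − j' n' = P₂` (`0 ≤ j < j'`) then
`|n|, |n'| ≤ |P₁| + |P₂|`. [folklore] -/
private theorem sameV_bound (j j' P₁ P₂ n n' : ℤ) (hj : 0 ≤ j) (hjj' : j < j')
    (h1 : n ^ 2 - n' ^ 2 = P₁) (h2 : j * n - j' * n' = P₂) :
    |n| ≤ |P₁| + |P₂| ∧ |n'| ≤ |P₁| + |P₂| := by
  have hfac : (n - n') * (n + n') = P₁ := by rw [← h1]; ring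
  have hP₁ := abs_nonneg P₁
  have hP₂ := abs_nonneg P₂
  by_cases hP : P₁ = 0
  · rw [hP] at hfac
    rw [hP, abs_zero, zero_add]
    rcases mul_eq_zero.1 hfac with h0 | h0
    · have hnn' : n' = n := by linarith
      have e : (j - j') * n = P₂ := by linear_combination h2 - j' * h0
      have hb : |n| ≤ |P₂| := abs_le_of_ne_zero_mul _ _ _ e (by omega)
      rw [hnn']
      exact ⟨hb, hb⟩
    · have hnn' : n' = -n := by linarith
      have e : (j + j') * n = P₂ := by linear_combination h2 + j' * h0
      have hb : |n| ≤ |P₂| := abs_le_of_ne_zero_mul _ _ _ e (by omega)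
      rw [hnn', abs_neg]
      exact ⟨hb, hb⟩
  · obtain ⟨hu, hw⟩ := abs_le_of_mul_eq_ne_zero _ _ _ hfac hP
    rw [abs_le] at hu hw
    constructor
    · rw [abs_le]
      constructor <;> linarith
    · rw [abs_le]
      constructor <;> linarith

/-- Transfer of positive definiteness: if `(A, B, C) ∥ (a, b, c)` in the sense `A b = B a`,
`A c = C a` with `0 < A`, `a ≠ 0`, then `B² < A C` gives `b² < a c`. [folklore] -/
private theorem disc_transfer (A B C : ℝ) (a b c : ℤ) (hA : 0 < A) (hBAC : B ^ 2 < A * C)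
    (ha : a ≠ 0) (hi : A * b = B * a) (hii : A * c = C * a) : b ^ 2 < a * c := by
  have ha' : (a : ℝ) ≠ 0 := by exact_mod_cast ha
  have key : A ^ 2 * ((a : ℝ) * c - (b : ℝ) ^ 2) = (a : ℝ) ^ 2 * (A * C - B ^ 2) := by
    linear_combination (A * a) * hii - (A * b + B * a) * hi
  have hpos : 0 < (a : ℝ) ^ 2 * (A * C - B ^ 2) := mul_pos (by positivity) (by linarith)
  rw [← key] at hpos
  have h3 : 0 < (a : ℝ) * c - (b : ℝ) ^ 2 := pos_of_mul_pos_right hpos (by positivity)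
  exact_mod_cast (show ((b : ℝ)) ^ 2 < (a : ℝ) * (c : ℝ) by linarith)

/-- Cross-product step: two DIFFERENT integer relations `A P₁ + 2 B P₂ + C D = 0`,
`A Q₁ + 2 B Q₂ + C D = 0` with the same `D ≠ 0` force `(A, B, C)` to be parallel to an integer
vector `(a, b, c)` with `a ≠ 0` and (from `0 < A`, `B² < A C`) `b² < a c`. [folklore] -/
private theorem cross (A B C : ℝ) (P₁ P₂ Q₁ Q₂ D : ℤ) (hA : 0 < A) (hBAC : B ^ 2 < A * C)
    (hD : D ≠ 0) (hP : A * P₁ + 2 * B * P₂ + C * D = 0) (hQ : A * Q₁ + 2 * B * Q₂ + C * D = 0)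
    (hne : (P₁, P₂) ≠ (Q₁, Q₂)) :
    ∃ a b c : ℤ, a ≠ 0 ∧ b ^ 2 < a * c ∧ A * b = B * a ∧ A * c = C * a := by
  have hd₂ : P₂ - Q₂ ≠ 0 := by
    intro h0
    have hPQ₂ : P₂ = Q₂ := by omega
    have hPQ₂' : (P₂ : ℝ) = Q₂ := by exact_mod_cast hPQ₂
    have h1 : A * ((P₁ : ℝ) - Q₁) = 0 := by linear_combination hP - hQ - 2 * B * hPQ₂'
    have h2 : (P₁ : ℝ) - Q₁ = 0 := (mul_eq_zero.1 h1).resolve_left hA.ne'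
    have hPQ₁ : P₁ = Q₁ := by exact_mod_cast (show (P₁ : ℝ) = Q₁ by linarith)
    exact hne (by rw [hPQ₁, hPQ₂])
  have hi : A * (((-(D * (P₁ - Q₁)) : ℤ)) : ℝ) = B * ((2 * D * (P₂ - Q₂) : ℤ) : ℝ) := by
    push_cast
    linear_combination (-(D : ℝ)) * hP + (D : ℝ) * hQ
  have hii : A * ((2 * (P₁ * Q₂ - P₂ * Q₁) : ℤ) : ℝ) = C * ((2 * D * (P₂ - Q₂) : ℤ) : ℝ) := by
    push_cast
    linear_combination (2 * (Q₂ : ℝ)) * hP - (2 * (P₂ : ℝ)) * hQ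
  have ha : (2 * D * (P₂ - Q₂) : ℤ) ≠ 0 := mul_ne_zero (mul_ne_zero two_ne_zero hD) hd₂
  exact ⟨_, _, _, ha, disc_transfer A B C _ _ _ hA hBAC ha hi hii, hi, hii⟩

/-- Transfer of one relation: if `(A, B, C) ∥ (a, b, c)` (`A b = B a`, `A c = C a`, `A ≠ 0`)
then the real relation `A v₁ + 2 B v₂ + C D = 0` with integer `v₁, v₂, D` gives the integer
relation `a v₁ + 2 b v₂ + c D = 0`. [folklore] -/
private theorem rel_transfer (A B C : ℝ) (a b c v₁ v₂ D : ℤ) (hA : A ≠ 0) (hi : A * b = B * a)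
    (hii : A * c = C * a) (h : A * v₁ + 2 * B * v₂ + C * D = 0) :
    a * v₁ + 2 * b * v₂ + c * D = 0 := by
  have h1 : A * ((a * v₁ + 2 * b * v₂ + c * D : ℤ) : ℝ) = 0 := by
    push_cast
    linear_combination (a : ℝ) * h + 2 * (v₂ : ℝ) * hi + (D : ℝ) * hii
  exact_mod_cast (mul_eq_zero.1 h1).resolve_left hA

/-- The main bound: any set of integer pairs all satisfying the real coincidence relation
`A (n² − n'²) + 2 B (j n − j' n') + C (j² − j'²) = 0` (`0 < A`, `B² < A C`, `0 ≤ j < j'`)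
is finite. [folklore] -/
private theorem finite_of_rel (A B C : ℝ) (j j' : ℤ) (hA : 0 < A) (hBAC : B ^ 2 < A * C)
    (hj : 0 ≤ j) (hjj' : j < j') (S : Set (ℤ × ℤ))
    (hS : ∀ p ∈ S, A * ((p.1 ^ 2 - p.2 ^ 2 : ℤ) : ℝ) + 2 * B * ((j * p.1 - j' * p.2 : ℤ) : ℝ) +
      C * ((j ^ 2 - j' ^ 2 : ℤ) : ℝ) = 0) : S.Finite := by
  suffices hN : ∃ N : ℤ, ∀ p ∈ S, |p.1| ≤ N ∧ |p.2| ≤ N by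
    obtain ⟨N, hN⟩ := hN
    refine ((Set.finite_Icc (-N) N).prod (Set.finite_Icc (-N) N)).subset fun p hp => ?_
    obtain ⟨h1, h2⟩ := hN p hp
    exact Set.mem_prod.2 ⟨Set.mem_Icc.2 (abs_le.1 h1), Set.mem_Icc.2 (abs_le.1 h2)⟩
  rcases S.eq_empty_or_nonempty with hempty | ⟨p₀, hp₀⟩
  · exact ⟨0, fun p hp => by simp [hempty] at hp⟩
  by_cases hcase : ∀ q ∈ S,
      (q.1 ^ 2 - q.2 ^ 2, j * q.1 - j' * q.2) = (p₀.1 ^ 2 - p₀.2 ^ 2, j * p₀.1 - j' * p₀.2)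
  · -- incommensurable case: one common `v`
    refine ⟨|p₀.1 ^ 2 - p₀.2 ^ 2| + |j * p₀.1 - j' * p₀.2|, fun q hq => ?_⟩
    have hv := hcase q hq
    rw [Prod.mk.injEq] at hv
    exact sameV_bound j j' _ _ q.1 q.2 hj hjj' hv.1 hv.2
  · -- commensurable case: two different `v`
    push Not at hcase
    obtain ⟨q, hq, hne⟩ := hcase
    have hD : (j ^ 2 - j' ^ 2 : ℤ) ≠ 0 := by
      have := sq_sub_sq_pos hj hjj'
      intro h0
      linarith
    obtain ⟨a, b, c, ha, hbac, hi, hii⟩ :=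
      cross A B C _ _ _ _ _ hA hBAC hD (hS q hq) (hS p₀ hp₀) hne
    refine ⟨(a * c - b ^ 2) * (j' ^ 2 - j ^ 2) + |b| * j', fun r hr => ?_⟩
    have hint := rel_transfer A B C a b c _ _ _ hA.ne' hi hii (hS r hr)
    exact intForm_bound a b c j j' r.1 r.2 ha hbac hj hjj' (by linear_combination hint)

/-- Stub S4 (cross-line coincidences are finite).  For real Gram data `0 < A`, `B² < A C` and
integers `0 ≤ j < j'`, only finitely many pairs `(n, n') ∈ ℤ²` satisfy
`A n² + 2 B j n + C j² = A n'² + 2 B j' n' + C j'²`, i.e. two distinct lattice lines of a rank-2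
lattice share only finitely many (squared) norms. [folklore] -/
theorem stub_coincidenceFinite : ∀ (A B C : ℝ) (j j' : ℤ), 0 < A → B ^ 2 < A * C → 0 ≤ j → j < j' →
    Set.Finite {p : ℤ × ℤ | A * (p.1 : ℝ) ^ 2 + 2 * B * (j : ℝ) * (p.1 : ℝ) + C * (j : ℝ) ^ 2 =
      A * (p.2 : ℝ) ^ 2 + 2 * B * (j' : ℝ) * (p.2 : ℝ) + C * (j' : ℝ) ^ 2} := by
  intro A B C j j' hA hBAC hj hjj'
  refine finite_of_rel A B C j j' hA hBAC hj hjj' _ fun p hp => ?_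
  rw [Set.mem_setOf_eq] at hp
  push_cast
  linear_combination hp

end Summit.AtomisticToContinuum.Crystallization.Theorems.ThreeConeCertificateExactCertificate.Invisibility
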